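import Summits.MatrixMultiplication.OmegaCensus.DicyclicNoSubFourP3
import Summits.MatrixMultiplication.OmegaCensus.C2QuaternionLawModSixFour
import HarnessLib

/-!
# Dicyclic type with `A/⟨c₀⟩` not cyclic has `β ≤ law − 8`; `β(C₂ × Q_{4m})` for every `m ≥ 13`

ω-census, family (b3).  Framing: lottery ticket; floor = certified bounds/negative ranges.

With the P3 exclusion (`DicyclicNoSubFourP3.lean`) the `law − 4` value is impossible in dicyclic type whenever
`A/⟨c₀⟩` is not cyclic, so the mod-12 gap theorem leaves only `V ≤ law − 8`:

* `tpp_volume_dicyclic_quot_noncyclic_le`: dihedral-like `G(A, c₀)`, `c₀ ≠ 0`, `A/⟨c₀⟩` not cyclic,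
  `|A| ≡ 1 (mod 3)`, `|A| ≥ 52` ⇒ every TPP triple has `3|S||T||U| + 32 ≤ 8|A|`.
* `c2_quaternion_law_mod_six_four_all`: **`β(C₂ × Q_{4m}) = 16⌊2m/3⌋ = (32m − 32)/3` for every `m ≡ 4 (mod 6)`,
  `m ≥ 13`** — the census window `[(32m−32)/3, (32m−14)/3]` of `C2QuaternionLaw.lean` is closed completely (the classes
  `m ≡ 4 (mod 18)`, `m = 22, 40, 58, …`, were the last open ones after `c2_quaternion_law_mod_six_four'`).
* `c2_quaternion_law_all`: **`β(C₂ × Q_{4m})` for every `m ≥ 13`: `(32m − 8)/3` if `m ≡ 1 (mod 6)`, else `16⌊2m/3⌋`.**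
-/

namespace Summit.MatrixMultiplication.OmegaCensus

open Literature.Combinatorics.Additive Finset

section DihedralLike

variable {A : Type*} [AddCommGroup A] [DecidableEq A] [Fintype A] {G : Type} [Group G] [DecidableEq G]
  {ρ τ : A → G} {c₀ : A} {S T U : Finset G}

/-- **Dicyclic type with `A/⟨c₀⟩` not cyclic: `V ≤ law − 8`.**  Dihedral-like `G(A,c₀)`, `c₀ ≠ 0`, `A/⟨c₀⟩` not
cyclic, `|A| ≡ 1 (mod 3)`, `|A| ≥ 52`: every TPP triple has `3|S||T||U| + 32 ≤ 8|A|`. [folklore] -/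
theorem tpp_volume_dicyclic_quot_noncyclic_le
    (hρρ : ∀ a b, ρ a * ρ b = ρ (a + b)) (hρτ : ∀ a b, ρ a * τ b = τ (b - a))
    (hτρ : ∀ a b, τ a * ρ b = τ (a + b)) (hττ : ∀ a b, τ a * τ b = ρ (c₀ + b - a)) (hc₀ : c₀ ≠ 0)
    (hnq : ¬ ∃ g : A, ∀ x : A, x ∈ AddSubgroup.zmultiples g ∨ x + c₀ ∈ AddSubgroup.zmultiples g)
    (hρ : Function.Injective ρ) (hτ : Function.Injective τ) (hne : ∀ a b, ρ a ≠ τ b)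
    (hsurj : ∀ g, (∃ a, ρ a = g) ∨ (∃ a, τ a = g)) (hmod : Fintype.card A % 3 = 1) (hA : 52 ≤ Fintype.card A)
    (h : TripleProductProperty S T U) :
    3 * (S.card * T.card * U.card) + 32 ≤ 8 * Fintype.card A := by
  rcases tpp_volume_dicyclic_quot_noncyclic hρρ hρτ hτρ hττ hc₀ hnq hρ hτ hne hsurj hmod hA h with h32 | ⟨hV, -⟩
  · exact h32
  · exfalso
    have hshape := sub_four_shape_of_quot_noncyclic_P3 hρρ hρτ hτρ hττ hc₀ hnq hρ hτ hne hsurj hmod hA h hV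
    simp only at hshape
    have hV_TUS : 3 * (T.card * U.card * S.card) + 20 = 8 * Fintype.card A := by
      rw [show T.card * U.card * S.card = S.card * T.card * U.card by ring]; exact hV
    have hV_UST : 3 * (U.card * S.card * T.card) + 20 = 8 * Fintype.card A := by
      rw [show U.card * S.card * T.card = S.card * T.card * U.card by ring]; exact hV
    have hV_SUT : 3 * (S.card * U.card * T.card) + 20 = 8 * Fintype.card A := by
      rw [show S.card * U.card * T.card = S.card * T.card * U.card by ring]; exact hV
    have hV_TSU : 3 * (T.card * S.card * U.card) + 20 = 8 * Fintype.card A := by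
      rw [show T.card * S.card * U.card = S.card * T.card * U.card by ring]; exact hV
    have hV_UTS : 3 * (U.card * T.card * S.card) + 20 = 8 * Fintype.card A := by
      rw [show U.card * T.card * S.card = S.card * T.card * U.card by ring]; exact hV
    have three : ∀ {d e : ℕ}, d * e = 3 → (d = 1 ∧ e = 3) ∨ (d = 3 ∧ e = 1) := by
      intro d e hde
      have hd : d ∣ 3 := ⟨e, hde.symm⟩
      have hd3 : d ≤ 3 := Nat.le_of_dvd (by norm_num) hd
      interval_cases d <;> omega
    rcases hshape with ⟨et, eu, hp, hδ⟩ | ⟨es, eu, hp, hδ⟩ | ⟨es, et, hp, hδ⟩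
    · rcases three hp with ⟨hd, he⟩ | ⟨hd, he⟩
      · -- `T` domino, `U` threes, `S` odd: the P3 theorem for `(S, T, U)`
        exact no_sub_four_P3_of_c0_ne_zero hρρ hρτ hτρ hττ hc₀ hρ hτ hne hsurj h hδ hd (by omega) he (by omega) hV
      · -- `U` domino, `T` threes: roles `(S, U, T)`
        exact no_sub_four_P3_of_c0_ne_zero hρρ hρτ hτρ hττ hc₀ hρ hτ hne hsurj (tpp_reverse h.rotate) hδ he
          (by omega) hd (by omega) hV_SUT
    · rcases three hp with ⟨hd, he⟩ | ⟨hd, he⟩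
      · -- `S` domino, `U` threes, `T` odd: roles `(T, S, U)`
        exact no_sub_four_P3_of_c0_ne_zero hρρ hρτ hτρ hττ hc₀ hρ hτ hne hsurj (tpp_reverse h.rotate.rotate) hδ hd
          (by omega) he (by omega) hV_TSU
      · -- `U` domino, `S` threes, `T` odd: roles `(T, U, S)`
        exact no_sub_four_P3_of_c0_ne_zero hρρ hρτ hτρ hττ hc₀ hρ hτ hne hsurj h.rotate hδ he (by omega) hd
          (by omega) hV_TUS
    · rcases three hp with ⟨hd, he⟩ | ⟨hd, he⟩
      · -- `S` domino, `T` threes, `U` odd: roles `(U, S, T)`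
        exact no_sub_four_P3_of_c0_ne_zero hρρ hρτ hτρ hττ hc₀ hρ hτ hne hsurj h.rotate.rotate hδ hd (by omega) he
          (by omega) hV_UST
      · -- `T` domino, `S` threes, `U` odd: roles `(U, T, S)`
        exact no_sub_four_P3_of_c0_ne_zero hρρ hρτ hτρ hττ hc₀ hρ hτ hne hsurj (tpp_reverse h) hδ he (by omega) hd
          (by omega) hV_UTS

end DihedralLike

section C2Q

variable {m : ℕ} [NeZero m]

/-- **`m ≡ 4 (mod 6)`, `m ≥ 13`: every TPP triple of `C₂ × Q_{4m}` has `3|S||T||U| + 32 ≤ 32m`.** [folklore] -/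
theorem c2_quaternion_volume_mod_six_four_le (hmod : m % 6 = 4) (hm : 13 ≤ m)
    {S T U : Finset (Multiplicative (ZMod 2) × QuaternionGroup m)} (h : TripleProductProperty S T U) :
    3 * (S.card * T.card * U.card) + 32 ≤ 32 * m := by
  haveI : NeZero (2 * m) := ⟨by omega⟩
  obtain ⟨hc₀, hnq⟩ := z2_z2m_quot_half_noncyclic (m := m) ⟨m / 2, by omega⟩
  refine c2_quaternion_presentation (m := m) fun ρ τ c₀ hρρ hρτ hτρ hττ hρ hτ hne hsurj hc => ?_
  subst hc
  have hcard : Fintype.card (ZMod 2 × ZMod (2 * m)) = 4 * m := by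
    rw [Fintype.card_prod, ZMod.card, ZMod.card]; ring
  have key := tpp_volume_dicyclic_quot_noncyclic_le hρρ hρτ hτρ hττ hc₀ hnq hρ hτ hne hsurj (by rw [hcard]; omega)
    (by rw [hcard]; omega) h
  rw [hcard] at key
  omega

/-- **`β(C₂ × Q_{4m}) = 16⌊2m/3⌋ = (32m − 32)/3` for EVERY `m ≡ 4 (mod 6)`, `m ≥ 13`** (both halves kernel; the lower
bound is `c2_quaternion_volume_ge`). [folklore] -/
theorem c2_quaternion_law_mod_six_four_all (hmod : m % 6 = 4) (hm : 13 ≤ m) :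
    (∀ S T U : Finset (Multiplicative (ZMod 2) × QuaternionGroup m), TripleProductProperty S T U →
        S.card * T.card * U.card ≤ 16 * (2 * m / 3)) ∧
    ∃ S T U : Finset (Multiplicative (ZMod 2) × QuaternionGroup m), TripleProductProperty S T U ∧
      S.card * T.card * U.card = 16 * (2 * m / 3) := by
  refine ⟨fun S T U h => ?_, c2_quaternion_volume_ge (by omega)⟩
  have := c2_quaternion_volume_mod_six_four_le hmod hm h
  omega

/-- **`β(C₂ × Q_{4m})` for every `m ≥ 13`**: `(32m − 8)/3` if `m ≡ 1 (mod 6)` (`c2_quaternion_law_mod_six_one`), and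
`16⌊2m/3⌋` otherwise (`c2_quaternion_law`, `c2_quaternion_law_mod_six_four_all`). [folklore] -/
theorem c2_quaternion_law_all (hm : 13 ≤ m) :
    (∀ S T U : Finset (Multiplicative (ZMod 2) × QuaternionGroup m), TripleProductProperty S T U →
        S.card * T.card * U.card ≤ if m % 6 = 1 then (32 * m - 8) / 3 else 16 * (2 * m / 3)) ∧
    ∃ S T U : Finset (Multiplicative (ZMod 2) × QuaternionGroup m), TripleProductProperty S T U ∧
      S.card * T.card * U.card = if m % 6 = 1 then (32 * m - 8) / 3 else 16 * (2 * m / 3) := by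
  by_cases h1 : m % 6 = 1
  · simp only [if_pos h1]
    obtain ⟨hub, S, T, U, h, hV⟩ := c2_quaternion_law_mod_six_one h1 (by omega)
    refine ⟨fun S' T' U' h' => ?_, S, T, U, h, by omega⟩
    have := hub S' T' U' h'
    omega
  · simp only [if_neg h1]
    by_cases h4 : m % 6 = 4
    · exact c2_quaternion_law_mod_six_four_all h4 hm
    · exact c2_quaternion_law (by omega) (by omega)

end C2Q

end Summit.MatrixMultiplication.OmegaCensus
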